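import Literature.AlgebraicGeometry.Frobenioids.ArchimedeanProp35iiSplitMonoRetract
import HarnessLib

/-!
# Frobenioids II, Prop. 3.5 (ii) as typed for the ANGULAR Frobenioid `A` (`ArchFrd.Prop35ii_A`, FACT-LIST
# F-0861): the schema fails over EVERY base containing a split retract configuration — the `A`-twin of
# `ArchimedeanProp35iiSplitMonoRetract.lean`

Mochizuki, *The geometry of Frobenioids II: poly-Frobenioids*, Kyushu J. Math. **62** (2008) 401–460, §3,
Prop. 3.5 (ii), kurims p. 34 [cite: MochizukiFrdII2008, Prop 3.5 (ii) p.34] ("The Frobenioid `F` is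
quasi-isotropic", `F ∈ {C, A}`), Example 3.3 (iii) p. 29 (`A ⊆ C`, the isometries); [FrdI] §0 p. 18
(anchors, iso-subanchors) [cite: MochizukiFrdI2008, §0 p.18].

STATUS IN THE TREE. `ArchFrd.Prop35ii_A π` is PROVED over every base whose split monomorphisms are invertible
(`ArchFrd.prop35ii_A_of_splitMono`, p431087 ⊋ `ArchFrd.prop35ii_A (hTE)`), and its universal closure is
REFUTED over the hand-built bases `RB` (`ArchFrd.not_prop35ii_A_retract`, p430162) and `T`
(`ArchFrd.P35iiToy.not_prop35ii_A`, p430058).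

THIS PROOF-ONLY FILE (abc-iut cell, block F, seat abc-iut-f-014; no definition, no instance) transports the
general mechanism of the `C`-file to `A` (all arrows involved are isometries: `(𝟙, r)` has identity
`C₀`-component, the complementary factor has the `C₀`-component of the given arrow of `A`, and the comparison
arrow to the tip-`1` object is an isometry, `C0.isIsometry_toUnitObj`):

* `A.not_isIrreducibleHom_of_isSplitMono`, `A.isAnchor_of_isSplitMono`, `A.isSubanchor_of_hom_to_retract`;
* `A.isIso_of_isSplitMono` (a split monomorphism of `A` over a split-mono-rigid base point is invertible —
  its image in `C` is, and the retraction is its inverse), `A.isIsoSubanchor_of_retractConfig`;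
* **`not_prop35ii_A_of_retractConfig`**, **`not_prop35ii_A_of_isSplitMono`**: over EVERY base `π : D → D₀`
  with `baseRC π` of RC-iso-subanchor type containing `e′ ⟶ p`, `r : p ⟶ e` (`r` a non-invertible split
  monomorphism, `e′` split-mono-rigid) the typed `Prop35ii_A π` is FALSE; `not_prop35ii_A_treeWitnesses_of_isSplitMono`
  recovers both tree witnesses (`RB`, `T`) as instances.

READING as in the `C`-file: a statement about OUR typed row F-0861 (schema without print's "totally
epimorphic"); no statement of the paper is touched; nothing bears on [IUTchIII] Cor. 3.12; typed ≠ proved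
except where a `theorem` says so.
-/

namespace Literature.AlgebraicGeometry.Frobenioids

open CategoryTheory

noncomputable section

namespace ArchFrd

universe v u

variable {D : Type u} [Category.{v} D] (π : D ⥤ D0)

namespace A

variable {π}

/-! ### Objects of `A` over a point with a non-invertible split monomorphism are anchors, vacuously -/

/-- **No arrow of `A` out of an object whose base point carries a non-invertible split monomorphism `r` of
`D` is irreducible**: the factorisation `φ = (𝟙, r) ≫ (φ₀, retraction r ≫ φ_D)` of the `C`-file consists of
isometries, and neither factor is invertible (their images in `C` are not). [cite: MochizukiFrdI2008, §0 p.17] -/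
theorem not_isIrreducibleHom_of_isSplitMono {X Y : A π} (φ : X ⟶ Y) {e : D} (r : X.obj.snd ⟶ e)
    [IsSplitMono r] (hr : ¬ IsIso r) : ¬ IsIrreducibleHom φ := by
  haveI := C.isIso_map_of_isSplitMono (π := π) r
  -- the intermediate object `(X₀, e)` and the two factors, in `C`
  let X'c : C π := ⟨X.obj.fst, e, X.obj.iso ≪≫ asIso (π.map r)⟩
  let ζc : X.obj ⟶ X'c := ⟨𝟙 X.obj.fst, r, by simp [X'c]⟩
  have hw := φ.hom.w
  have hre : π.map r ≫ π.map (retraction r ≫ φ.hom.snd) = π.map φ.hom.snd := by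
    rw [← π.map_comp, ← Category.assoc, IsSplitMono.id, Category.id_comp]
  let φ'c : X'c ⟶ Y.obj := ⟨φ.hom.fst, (retraction r ≫ φ.hom.snd : e ⟶ Y.obj.snd), by
    simp only [X'c, Iso.trans_hom, asIso_hom, Category.assoc, hre]
    exact hw⟩
  -- … and in `A` (both are isometries)
  let X' : A π := ⟨X'c⟩
  have hζ : PreFrobenioid.IsIsometry C0.toElem (𝟙 X.obj.fst) :=
    (PreFrobenioid.isometricMorphisms C0.toElem).id_mem _
  let ζ : X ⟶ X' := ⟨ζc, hζ⟩
  let φ' : X' ⟶ Y := ⟨φ'c, φ.property⟩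
  have hfac : ζ ≫ φ' = φ := by
    refine WideSubcategory.hom_ext _ (CFP.hom_ext (Category.id_comp _) ?_)
    have h : (r ≫ retraction r ≫ φ.hom.snd : X.obj.snd ⟶ Y.obj.snd) = φ.hom.snd := by
      rw [← Category.assoc, IsSplitMono.id, Category.id_comp]
    exact h
  intro hφ
  rcases hφ.2 ζ φ' hfac with h | h
  · haveI := h
    haveI : IsIso φ'c := (inferInstance : IsIso ((A.ι π).map φ'))
    haveI : IsIso (retraction r ≫ φ.hom.snd) := CFP.isIso_snd φ'c
    exact hr (isIso_of_isIso_retraction_comp r φ.hom.snd)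
  · haveI := h
    haveI : IsIso ζc := (inferInstance : IsIso ((A.ι π).map ζ))
    exact hr (CFP.isIso_snd ζc)

/-- **Such an object is an anchor of `A`**, vacuously. [cite: MochizukiFrdI2008, §0 p.18] -/
theorem isAnchor_of_isSplitMono (X : A π) {e : D} (r : X.obj.snd ⟶ e) [IsSplitMono r]
    (hr : ¬ IsIso r) : IsAnchor X := by
  refine Set.Finite.subset Set.finite_empty ?_
  rintro x ⟨f, hf, -⟩
  exact (not_isIrreducibleHom_of_isSplitMono f.hom r hr hf).elim

/-- **Every object of `A` whose base point maps to a point carrying a non-invertible split monomorphism is a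
subanchor of `A`** — via the ISOMETRY to the tip-`1` object over that point (`C0.isIsometry_toUnitObj`).
[cite: MochizukiFrdI2008, §0 p.18] -/
theorem isSubanchor_of_hom_to_retract (X : A π) {p e : D} (g : X.obj.snd ⟶ p) (r : p ⟶ e)
    [IsSplitMono r] (hr : ¬ IsIso r) : IsSubanchor X := by
  haveI : IsSplitMono (show (⟨unitObjOver π p⟩ : A π).obj.snd ⟶ e from r) := ‹IsSplitMono r›
  refine ⟨⟨unitObjOver π p⟩,
    isAnchor_of_isSplitMono (⟨unitObjOver π p⟩ : A π) (show (unitObjOver π p).snd ⟶ e from r) hr,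
    ⟨⟨toUnitObjOver π X.obj g, ?_⟩⟩⟩
  change PreFrobenioid.IsIsometry (C.toElem π) (toUnitObjOver π X.obj g)
  change pull Φ₀ X.obj.iso.inv (PreFrobenioid.Div C0.toElem (C0.toUnitObj X.obj.fst _)) = 1
  rw [C0.isIsometry_toUnitObj]
  exact map_one _

/-! ### Split monomorphisms of `A` over split-mono-rigid base points -/

/-- A split monomorphism of `A` whose base point is split-mono-rigid in `D` is invertible: its image in `C` is
(`C.isIso_of_isSplitMono`), and the retraction in `A` is then a two-sided inverse.
[cite: MochizukiFrdII2008, Ex 3.3 (iii) p.29] -/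
theorem isIso_of_isSplitMono {X Y : A π} (ζ : X ⟶ Y) [IsSplitMono ζ]
    (hX : ∀ ⦃d : D⦄ (s : X.obj.snd ⟶ d), IsSplitMono s → IsIso s) : IsIso ζ := by
  have hid : ζ ≫ retraction ζ = 𝟙 X := IsSplitMono.id ζ
  have hidc : ζ.hom ≫ (retraction ζ).hom = 𝟙 X.obj := congrArg InducedWideCategory.Hom.hom hid
  haveI : IsSplitMono ζ.hom := IsSplitMono.mk' ⟨(retraction ζ).hom, hidc⟩
  haveI : IsIso ζ.hom := C.isIso_of_isSplitMono ζ.hom hX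
  refine ⟨⟨retraction ζ, hid, WideSubcategory.hom_ext _ ?_⟩⟩
  change (retraction ζ).hom ≫ ζ.hom = 𝟙 Y.obj
  rw [← IsIso.inv_eq_of_hom_inv_id hidc, IsIso.inv_hom_id]

/-- **Over a split-mono-rigid point `e′` mapping to a point `p` that carries a non-invertible split
monomorphism, EVERY object of `A` is an iso-subanchor** (via the identity; [FrdI] §0 exact scope, p437586).
[cite: MochizukiFrdI2008, §0 p.18] -/
theorem isIsoSubanchor_of_retractConfig (X : A π) {p e : D} (g : X.obj.snd ⟶ p) (r : p ⟶ e)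
    [IsSplitMono r] (hr : ¬ IsIso r) (hX : ∀ ⦃d : D⦄ (s : X.obj.snd ⟶ d), IsSplitMono s → IsIso s) :
    IsIsoSubanchor X :=
  isIsoSubanchor_of_isSubanchor_of_splitMono (isSubanchor_of_hom_to_retract X g r hr)
    fun _ ζ _ => isIso_of_isSplitMono ζ hX

end A

/-! ### Prop. 3.5 (ii) for `A` fails over every base with a split retract configuration -/

/-- **[FrdII] Prop. 3.5 (ii) as typed for `A` is FALSE over every base `π : D → D₀` of RC-iso-subanchor type
containing a split retract configuration** `e′ ⟶ p`, `r : p ⟶ e` (`r` a non-invertible split monomorphism,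
`e′` split-mono-rigid): the isotropic tip-`1` object over `e′` is an iso-subanchor of `A` (isotropic in `A` iff
in `C`, Ex. 3.3 (iii); in `C` iff naively, Ex. 3.3 (ii)). [cite: MochizukiFrdII2008, Prop 3.5 (ii) p.34] -/
theorem not_prop35ii_A_of_retractConfig (hRC : RC.IsOfRCIsoSubanchorType (baseRC π)) {e' p e : D}
    (g : e' ⟶ p) (r : p ⟶ e) [IsSplitMono r] (hr : ¬ IsIso r)
    (he' : ∀ ⦃d : D⦄ (s : e' ⟶ d), IsSplitMono s → IsIso s) :
    ¬ Literature.AlgebraicGeometry.Frobenioids.ArchFrd.Prop35ii_A π := fun h =>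
  (h hRC ⟨unitObjOver π e'⟩).2 (A.isIsoSubanchor_of_retractConfig ⟨unitObjOver π e'⟩ g r hr he')
    ((Ex33iii_isotropic_iff_holds π ⟨unitObjOver π e'⟩).2
      ((Ex33ii_isotropic_iff_holds π (unitObjOver π e')).2 (AngularRegion.isIsotropic_isotropicOfTip 1)))

/-- The walking-retract form `e′ := e` (the codomain of `r` is split-mono-rigid).
[cite: MochizukiFrdII2008, Prop 3.5 (ii) p.34] -/
theorem not_prop35ii_A_of_isSplitMono (hRC : RC.IsOfRCIsoSubanchorType (baseRC π)) {p e : D}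
    (r : p ⟶ e) [IsSplitMono r] (hr : ¬ IsIso r)
    (he : ∀ ⦃d : D⦄ (s : e ⟶ d), IsSplitMono s → IsIso s) :
    ¬ Literature.AlgebraicGeometry.Frobenioids.ArchFrd.Prop35ii_A π :=
  not_prop35ii_A_of_retractConfig π hRC (retraction r) r hr he

/-- **Both hand-built witnesses of the tree are instances** (re-derived from `not_prop35ii_A_of_isSplitMono`;
packaged as one conjunction so as not to restate `ArchFrd.not_prop35ii_A_retract` (base `RB`, p430162) and
`ArchFrd.P35iiToy.not_prop35ii_A` (base `T`, p430058)). [cite: MochizukiFrdII2008, Prop 3.5 (ii) p.34] -/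
theorem not_prop35ii_A_treeWitnesses_of_isSplitMono :
    ¬ Literature.AlgebraicGeometry.Frobenioids.ArchFrd.Prop35ii_A πR ∧
      ¬ Literature.AlgebraicGeometry.Frobenioids.ArchFrd.Prop35ii_A P35iiToy.toD0 := by
  constructor
  · haveI : IsSplitMono RB.r := IsSplitMono.mk' ⟨RB.s, RB.r_comp_s⟩
    exact not_prop35ii_A_of_isSplitMono πR RB.isOfRCIsoSubanchorType RB.r (RB.not_isIso_from_pt RB.r)
      fun _ ζ hζ => by haveI := hζ; exact RB.isIso_of_mono ζ
  · haveI : IsSplitMono (P35iiToy.T.sec false) := P35iiToy.T.isSplitMono_sec false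
    exact not_prop35ii_A_of_isSplitMono P35iiToy.toD0 P35iiToy.isOfRCIsoSubanchorType_toD0
      (P35iiToy.T.sec false) (P35iiToy.T.not_isIso_sec false)
      ((isMonoMinimalQuotient_bot_id_iff P35iiToy.T.e).mp P35iiToy.T.isMonoMinimalQuotient_bot_id_e)

/-- **Joint form for the two Frobenioids of Prop. 3.5 (ii)**: over every RC-typed base with a non-invertible
split monomorphism whose codomain is split-mono-rigid, BOTH typed instances `Prop35ii_C π` and `Prop35ii_A π`
fail. [cite: MochizukiFrdII2008, Prop 3.5 (ii) p.34] -/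
theorem not_prop35ii_C_and_not_prop35ii_A_of_isSplitMono (hRC : RC.IsOfRCIsoSubanchorType (baseRC π))
    {p e : D} (r : p ⟶ e) [IsSplitMono r] (hr : ¬ IsIso r)
    (he : ∀ ⦃d : D⦄ (s : e ⟶ d), IsSplitMono s → IsIso s) :
    ¬ Literature.AlgebraicGeometry.Frobenioids.ArchFrd.Prop35ii_C π ∧
      ¬ Literature.AlgebraicGeometry.Frobenioids.ArchFrd.Prop35ii_A π :=
  ⟨not_prop35ii_C_of_isSplitMono π hRC r hr he, not_prop35ii_A_of_isSplitMono π hRC r hr he⟩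

end ArchFrd

end

end Literature.AlgebraicGeometry.Frobenioids
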